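import Mathlib
import HarnessLib

/-!
# Matrices with entries in a subfield of `ℂ`; dense conjugation-stable subfields

Bookkeeping for "`K`-rational matrices", `K ⊆ ℂ` a subfield: the predicate `IsKMat K A := ∀ i j, A i j ∈ K`
and its closure under the ring operations, `ᴴ` (when `K` is stable under complex conjugation), `det`,
`adjugate` and `⁻¹`; density of `K`-matrices when `K` is dense (`dense_isKMat`); and the standard facts that
a subfield of `ℂ` containing a non-real number is dense (`Subfield.dense_of_im_ne_zero` — it contains
`ℚ + ℚ z`, whose closure is `ℝ + ℝ z = ℂ`), that the image of a non-real complex embedding of a field is dense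
(`dense_fieldRange_of_not_isReal`, in particular every embedding of a totally complex number field,
`dense_fieldRange_of_isTotallyComplex`), and that the image of a CM field is conjugation-stable
(`conj_mem_fieldRange_of_isCMField`).  All elementary. [folklore]

These are the hypotheses "`K` dense and `conj`-stable, `H ∈ Mₙ(K)`" of the real-approximation theorem for
unitary groups `Literature/GroupTheory/ArithmeticGroups/UnitaryRealApproximation.lean`, discharged for the
image `K = ι(L)` of a CM field `L` under any complex embedding `ι`.

## Design

`IsKMat` is a bare predicate (not a subring) because it is used for rectangular matrices and under `ᴴ`;
`IsKMat.exists_map` / `IsKMat.of_map` translate to Mathlib's `K.subtype.mapMatrix`.  The same predicate occurs,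
specialised to its quantum-Turing-machine context, as `Literature.Computability.Cryptography.QTM.EntriesIn`
(file `QuantumTuringMachineHeadCentredEntries.lean`, which imports the QTM development); this file is the
general-purpose linear-algebra home and does not import that one (`QTM.EntriesIn K A ↔ IsKMat K A` is `Iff.rfl`).

## Provenance

Staged by the pub-hodgecm formalisation cell (DAG-node prover #01 lineage) under the LEAN-IN-TREE rule; it
supersedes lines 57–178 of the cell's standalone package file `HodgeCM/PerL34/RealApproximation.lean`
(namespace `HodgeCM.PerL34.RealApproximation` ↦ `Literature.LinearAlgebra.Matrix`, same short names).

## Not here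

The Cayley-transform density theorem itself (`UnitaryRealApproximation.lean`).
-/

set_option autoImplicit false

noncomputable section

open Matrix Topology Filter
open scoped ComplexConjugate

namespace Literature.LinearAlgebra.Matrix

variable {m n : Type*} [Fintype n] [DecidableEq n]

/-! ## Matrices with entries in a subfield `K ⊆ ℂ` -/

/-- `A` has all its entries in the subfield `K`. [folklore] -/
def IsKMat (K : Subfield ℂ) {m m' : Type*} (A : Matrix m m' ℂ) : Prop := ∀ i j, A i j ∈ K

namespace IsKMat

variable {K : Subfield ℂ}

/-- A square `K`-matrix is the image of a matrix over `K` under `K.subtype.mapMatrix`. [folklore] -/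
theorem exists_map {A : Matrix n n ℂ} (hA : IsKMat K A) : ∃ B : Matrix n n K, K.subtype.mapMatrix B = A :=
  ⟨Matrix.of fun i j => ⟨A i j, hA i j⟩, by ext i j; rfl⟩

/-- Images under `K.subtype.mapMatrix` are `K`-matrices. [folklore] -/
theorem of_map (B : Matrix n n K) : IsKMat K (K.subtype.mapMatrix B) :=
  fun i j => (B i j).2

/-- `0` is a `K`-matrix. [folklore] -/
theorem zero {m m' : Type*} : IsKMat K (0 : Matrix m m' ℂ) := fun _ _ => K.zero_mem

omit [Fintype n] in
/-- `1` is a `K`-matrix. [folklore] -/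
theorem one : IsKMat K (1 : Matrix n n ℂ) := by
  intro i j
  rw [Matrix.one_apply]
  split_ifs
  · exact K.one_mem
  · exact K.zero_mem

/-- Sums of `K`-matrices. [folklore] -/
theorem add {m m' : Type*} {A B : Matrix m m' ℂ} (hA : IsKMat K A) (hB : IsKMat K B) : IsKMat K (A + B) :=
  fun i j => K.add_mem (hA i j) (hB i j)

/-- Negatives of `K`-matrices. [folklore] -/
theorem neg {m m' : Type*} {A : Matrix m m' ℂ} (hA : IsKMat K A) : IsKMat K (-A) :=
  fun i j => K.neg_mem (hA i j)

/-- Differences of `K`-matrices. [folklore] -/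
theorem sub {m m' : Type*} {A B : Matrix m m' ℂ} (hA : IsKMat K A) (hB : IsKMat K B) : IsKMat K (A - B) :=
  fun i j => K.sub_mem (hA i j) (hB i j)

/-- `K`-scalar multiples of `K`-matrices. [folklore] -/
theorem smul {m m' : Type*} {A : Matrix m m' ℂ} {c : ℂ} (hc : c ∈ K) (hA : IsKMat K A) : IsKMat K (c • A) :=
  fun i j => by simpa [Matrix.smul_apply] using K.mul_mem hc (hA i j)

/-- Products of `K`-matrices. [folklore] -/
theorem mul {l m m' : Type*} [Fintype m] {A : Matrix l m ℂ} {B : Matrix m m' ℂ} (hA : IsKMat K A)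
    (hB : IsKMat K B) : IsKMat K (A * B) := fun i j => by
  rw [Matrix.mul_apply]
  exact K.sum_mem fun k _ => K.mul_mem (hA i k) (hB k j)

/-- If `K` is stable under complex conjugation, `K`-matrices are stable under `ᴴ`. [folklore] -/
theorem conjTranspose {m m' : Type*} (hK : ∀ z ∈ K, conj z ∈ K) {A : Matrix m m' ℂ} (hA : IsKMat K A) :
    IsKMat K Aᴴ := fun i j => by
  rw [Matrix.conjTranspose_apply]
  exact hK _ (hA j i)

/-- Determinants of `K`-matrices lie in `K`. [folklore] -/
theorem det_mem {A : Matrix n n ℂ} (hA : IsKMat K A) : A.det ∈ K := by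
  obtain ⟨B, rfl⟩ := hA.exists_map
  rw [← RingHom.map_det]
  exact (B.det).2

/-- Adjugates of `K`-matrices. [folklore] -/
theorem adjugate {A : Matrix n n ℂ} (hA : IsKMat K A) : IsKMat K A.adjugate := by
  obtain ⟨B, rfl⟩ := hA.exists_map
  rw [← RingHom.map_adjugate]
  exact of_map _

/-- Inverses of `K`-matrices (Mathlib's `⁻¹ = det⁻¹ • adjugate`). [folklore] -/
theorem inv {A : Matrix n n ℂ} (hA : IsKMat K A) : IsKMat K A⁻¹ := by
  rw [Matrix.inv_def, Ring.inverse_eq_inv']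
  exact (hA.adjugate).smul (K.inv_mem hA.det_mem)

end IsKMat


/-- `K`-matrices are dense as soon as `K` is dense in `ℂ`. [folklore] -/
theorem dense_isKMat {K : Subfield ℂ} (hKd : Dense (K : Set ℂ)) (m m' : Type*) :
    Dense {A : Matrix m m' ℂ | IsKMat K A} := by
  have h : DenseRange (Pi.map fun _ : m => Pi.map fun _ : m' => ((↑) : K → ℂ)) :=
    DenseRange.piMap fun _ => DenseRange.piMap fun _ => hKd.denseRange_val
  refine Dense.mono ?_ h
  rintro _ ⟨B, rfl⟩ i j
  exact (B i j).2

/-! ## Dense conjugation-stable subfields: the image of a CM field -/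

/-- A subfield of `ℂ` containing a non-real number is dense (it contains `ℚ + ℚ z`). [folklore] -/
theorem Subfield.dense_of_im_ne_zero (K : Subfield ℂ) {z : ℂ} (hz : z ∈ K) (hz' : z.im ≠ 0) :
    Dense (K : Set ℂ) := by
  let φ : ℝ × ℝ → ℂ := fun p => (p.1 : ℂ) + (p.2 : ℂ) * z
  have hφc : Continuous φ := by
    simp only [φ]
    fun_prop
  have hφs : Function.Surjective φ := by
    intro w
    refine ⟨(w.re - w.im / z.im * z.re, w.im / z.im), ?_⟩
    apply Complex.ext
    · simp [φ]
    · simp [φ]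
      field_simp
  have hg : DenseRange (Prod.map ((↑) : ℚ → ℝ) ((↑) : ℚ → ℝ)) :=
    Rat.denseRange_cast.prodMap Rat.denseRange_cast
  have hd : DenseRange (φ ∘ Prod.map ((↑) : ℚ → ℝ) ((↑) : ℚ → ℝ)) := hφs.denseRange.comp hg hφc
  refine Dense.mono ?_ hd
  rintro _ ⟨⟨p, q⟩, rfl⟩
  simp only [Function.comp_apply, Prod.map_apply, φ, Complex.ofReal_ratCast]
  exact K.add_mem (SubfieldClass.ratCast_mem K p) (K.mul_mem (SubfieldClass.ratCast_mem K q) hz)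

/-- The image of a non-real complex embedding of a field is dense in `ℂ`. [folklore] -/
theorem dense_fieldRange_of_not_isReal {L : Type*} [Field L] (ι : L →+* ℂ)
    (h : ¬ NumberField.ComplexEmbedding.IsReal ι) : Dense (ι.fieldRange : Set ℂ) := by
  rw [NumberField.ComplexEmbedding.isReal_iff] at h
  obtain ⟨x, hx⟩ : ∃ x, NumberField.ComplexEmbedding.conjugate ι x ≠ ι x := by
    by_contra hall
    push Not at hall
    exact h (RingHom.ext hall)
  rw [NumberField.ComplexEmbedding.conjugate_coe_eq, Ne, Complex.conj_eq_iff_im] at hx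
  exact Subfield.dense_of_im_ne_zero _ (ι.mem_fieldRange.mpr ⟨x, rfl⟩) hx

/-- Every complex embedding of a totally complex field (e.g. a CM field) has dense image. [folklore] -/
theorem dense_fieldRange_of_isTotallyComplex {L : Type*} [Field L] [NumberField L]
    [NumberField.IsTotallyComplex L] (ι : L →+* ℂ) : Dense (ι.fieldRange : Set ℂ) :=
  dense_fieldRange_of_not_isReal ι (NumberField.IsTotallyComplex.complexEmbedding_not_isReal ι)

/-- The image of a CM field under a complex embedding is stable under complex conjugation. [folklore] -/
theorem conj_mem_fieldRange_of_isCMField {L : Type*} [Field L] [NumberField L] [NumberField.IsCMField L]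
    (ι : L →+* ℂ) : ∀ z ∈ ι.fieldRange, conj z ∈ ι.fieldRange := by
  rintro _ ⟨x, rfl⟩
  exact ⟨NumberField.IsCMField.complexConj L x, NumberField.IsCMField.complexEmbedding_complexConj L ι x⟩


end Literature.LinearAlgebra.Matrix
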